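import Literature.AlgebraicGeometry.Resolution.InseparableLocalUniformizationDefect
import Mathlib.FieldTheory.PurelyInseparable.PerfectClosure
import HarnessLib

/-!
# Inseparable local uniformization: the Abhyankar case as printed (Temkin 2013, Thm. 5.5.2 (i))

Topic: `Literature/AlgebraicGeometry/Resolution`. Additive companion to
`InseparableLocalUniformizationDefect.lean`, which performs the induction on the transcendence
defect in the proof of M. Temkin, *Inseparable local uniformization*, J. Algebra 373 (2013)
65–119 = arXiv:0804.1554v3 (numbers and pages of the journal version = v3), Thm. 4.1.1, from the
named facts `Temkin2013DescentAbhyankar` (the induction base, stated in the shape of Thm. 4.1.1: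
height `≤ 1`, normal affine model, `L₁ = LK₁ ⊇ L ⊇ l`) and `Temkin2013DescentDefectStep`, giving
the frontier `{Temkin2013DescentAbhyankar, Temkin2013DescentDefectStep,
Temkin2013HeightStepOfDescent}` of the corrected Thm. 1.3.2 (`Temkin2013Relative.of_defect_frontier`).

This file SHARPENS the base fact to the result the paper actually proves in §5:

* `Temkin2013Abhyankar` — NAMED FACT, **Thm. 5.5.2 (i) in the case `n = 1`**, logarithmic data
  dropped: for a finitely generated ABHYANKAR valued `k`-field `K` (`k` trivially valued; NO
  height assumption), ANY affine `k`-model `X` of `K°` (no normality) and a finite extension of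
  valued fields `K₁/K`, there are a finite purely inseparable `l/k` and an affine refinement
  `X' → X` such that the centre of `(lK₁)°` on `Nr_{lK₁}(X')` is a simple `l`-smooth point; the
  extension of the function field is `L₁ = lK₁` itself (`Algebra.adjoin K₁ l = ⊤`, no separate
  `L/lK`).
* `Temkin2013Abhyankar.descentAbhyankar` — PROVED: `Temkin2013Abhyankar →
  Temkin2013DescentAbhyankar` (proof of Thm. 4.1.1, Step 0, p. 47: "The induction base
  `D_{K/k} = 0` corresponds to the case of Abhyankar valuations … it is a particular case of
  Theorem 5.5.2": take `L := K(l) ⊆ lK₁`, purely inseparable over `K` because `l/k` is —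
  `isPurelyInseparable_adjoin_of_isPurelyInseparable` —, containing `l` and generating `lK₁` over
  `K₁`; the extra hypotheses of the base fact, height `≤ 1` and normality of `X`, are simply not
  used).
* `Temkin2013Relative.of_abhyankar_frontier`, `Temkin2013.of_abhyankar_frontier`,
  `Temkin2013HeightLeOne.of_abhyankar_frontier`, `Temkin2013Descent.of_abhyankar` — PROVED
  corollaries through the landed `*.of_defect_frontier` / `Temkin2013Descent.of_defect`: the
  frontier of the corrected Thm. 1.3.2 may be taken to be `{Temkin2013Abhyankar (Thm. 5.5.2 (i)),
  Temkin2013DescentDefectStep (§4.1, Steps 1–4), Temkin2013HeightStepOfDescent (§4.2)}`.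

## Sources

* M. Temkin, *Inseparable local uniformization*, J. Algebra 373 (2013) 65–119 =
  arXiv:0804.1554v3: proof of Thm. 4.1.1, Step 0 (p. 47); §5.5, setup before Thm. 5.5.2 and
  Thm. 5.5.2 (pp. 59–60).

## Rendering notes

* As in `InseparableLocalUniformizationDescent.lean` / `…Defect.lean`: `k` trivially valued ↦
  `hk : ∀ c, algebraMap k K c ∈ O`; "`K` is Abhyankar" ↦ `transcendenceDefect k O hk = 0` (p. 10:
  "for a finite `N` the extension is Abhyankar if and only if `D_{l/k} = 0`"; `N < ℵ₀` as `K/k`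
  is finitely generated, `transcendenceDefect_eq_zero_iff`); "simple `l`-smooth" ↦
  `Algebra.IsSmoothAt l 𝔭 ∧ Algebra.FormallySmooth l k(𝔭) ∧` regular (cf. `not_temkin2013Rel`);
  `K₁/K` finite extension of valued fields ↦ `FiniteDimensional K K₁`, `O₁ ∩ K = O`; the affine
  model `X = Spec A` ↦ `A ⊆ K°` finitely generated over `k` with `Frac A = K`; `Nr_{L₁}(X')` ↦ the
  `l`-subalgebra `N` of `L₁` whose underlying set is the integral closure of `A'`.
-/

noncomputable section

open IsLocalRing

namespace Literature.AlgebraicGeometry.Resolution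

universe u

/-! ### Thm. 5.5.2 (i), `n = 1` -/

/-- NAMED FACT — **Temkin's local uniformization of Abhyankar valuations, the case `n = 1`
without logarithmic data** (Temkin 2013, §5.5, p. 59: "Assume that `k` is a trivially valued
field, `K` is a finitely generated Abhyankar valued `k`-field, `X` is an affine `k`-model of
`K°`, `x ∈ X` is the center of `K°`, and `K₁/K, …, K_n/K` are finite extensions of valued fields.
For an affine refinement `f : X' → X` let `x' ∈ X'` denote the center of `K°`. Furthermore, given
a finite purely inseparable extension `l/k` we provide each field `Lᵢ = lKᵢ` with the valuation
extending that of `Kᵢ`, set `Xᵢ = Nr_{Lᵢ}(X')`, and define `xᵢ ∈ Xᵢ` as the center of `Lᵢ°` on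
`Xᵢ`"; Thm. 5.5.2, p. 60: "(i) There exists a finite purely inseparable extension `l/k`, an
affine refinement `X' → X` and a Q-Cartier divisor `E' ⊂ X'` such that the pairs `(Xᵢ, Eᵢ)` and
`(X', E')` are log smooth at `xᵢ` and `x'`, respectively, and each projection `fᵢ` is Kummer at
`xᵢ`. In addition, one can achieve that `x₁` is a simple `l`-smooth point and all `xᵢ`'s are of
simplicial shape"). Vendored for `n = 1`, keeping of the conclusion only "`X'` refines `X`" and
"`x₁` is a simple `l`-smooth point" (a consequence of the printed statement). Hypotheses, in
order: `K/k` finitely generated; `k ⊆ O = K°`; `K` Abhyankar over `k`, i.e. `D_{K/k} = 0` — NO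
height or normality assumption, as printed; `X = Spec A` an affine model of `K°`; `K₁/K` finite
with a valuation ring `O₁ = K₁°` over `K°`. Conclusion: `L₁ ⊇ K₁` finite purely inseparable with
`l ⊆ L₁` finite purely inseparable over `k` and `L₁ = lK₁` (`Algebra.adjoin K₁ l = ⊤`); an affine
refinement `X' = Spec A'` of `X` inside `K°`; `O₁' = L₁°` over `K₁°` (the valuation extending that
of `K₁`, unique by pure inseparability); and the centre `𝔭` of `L₁°` on `N = Nr_{L₁}(X')` (an
affine model of `L₁°`) is `l`-smooth, simple (`Algebra.FormallySmooth l k(𝔭)`) and regular. It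
is the induction base `D = 0` of the proof of Thm. 4.1.1 (`Temkin2013Abhyankar.descentAbhyankar`)
and is strictly more general than `Temkin2013DescentAbhyankar`; its printed proof is toric /
logarithmic (§5: Abhyankar transcendence bases, toric monoids in the value lattice, Thms. 5.5.1,
5.5.3, A.2.1). Users take `(h : Temkin2013Abhyankar)`. [cite: Temkin2013, Thm. 5.5.2 (i)] -/
def Temkin2013Abhyankar : Prop :=
  ∀ (k K : Type u) [Field k] [Field K] [Algebra k K], (⊤ : IntermediateField k K).FG →
    ∀ O : ValuationSubring K, ∀ hk : (∀ c : k, algebraMap k K c ∈ O),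
      transcendenceDefect k O hk = 0 →
    ∀ A : Subalgebra k K, A.toSubring ≤ O.toSubring → A.FG → IsFractionRing A K →
    ∀ (K₁ : Type u) [Field K₁] [Algebra K K₁], FiniteDimensional K K₁ →
    ∀ O₁ : ValuationSubring K₁, O₁.comap (algebraMap K K₁) = O →
      ∃ (L₁ : Type u) (_ : Field L₁) (_ : Algebra K₁ L₁) (_ : Algebra K L₁) (_ : Algebra k L₁)
        (_ : IsScalarTower K K₁ L₁) (_ : IsScalarTower k K L₁),
        FiniteDimensional K₁ L₁ ∧ IsPurelyInseparable K₁ L₁ ∧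
        ∃ l : IntermediateField k L₁, FiniteDimensional k l ∧ IsPurelyInseparable k l ∧
          Algebra.adjoin K₁ (l : Set L₁) = ⊤ ∧
        ∃ (A' : Subalgebra k K), A ≤ A' ∧ A'.toSubring ≤ O.toSubring ∧ A'.FG ∧
          IsFractionRing A' K ∧
        ∃ O₁' : ValuationSubring L₁, O₁'.comap (algebraMap K₁ L₁) = O₁ ∧
        ∃ (N : Subalgebra l L₁) (hN : N.toSubring ≤ O₁'.toSubring),
          (N : Set L₁) = {x : L₁ | IsIntegral (A'.map (IsScalarTower.toAlgHom k K L₁)) x} ∧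
          (N.restrictScalars k).FG ∧ IsFractionRing N L₁ ∧
          Algebra.IsSmoothAt l (centreIdeal N O₁' hN) ∧
          Algebra.FormallySmooth l
            (IsLocalRing.ResidueField (Localization.AtPrime (centreIdeal N O₁' hN))) ∧
          IsRegularLocalRing (Localization.AtPrime (centreIdeal N O₁' hN))

section base

variable {k K L₁ : Type u} [Field k] [Field K] [Field L₁] [Algebra k K] [Algebra K L₁]
  [Algebra k L₁] [IsScalarTower k K L₁]

/-- `K(l)/K` is purely inseparable when `l/k` is (inside a common extension `L₁` of `K ⊇ k`):
"`L = lK`" for a purely inseparable `l/k` is purely inseparable over `K`. [folklore] -/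
theorem isPurelyInseparable_adjoin_of_isPurelyInseparable (l : IntermediateField k L₁)
    [IsPurelyInseparable k l] :
    IsPurelyInseparable K (IntermediateField.adjoin K (l : Set L₁)) := by
  haveI : ExpChar K (ringExpChar k) :=
    expChar_of_injective_algebraMap (algebraMap k K).injective (ringExpChar k)
  rw [IntermediateField.isPurelyInseparable_adjoin_iff_pow_mem K L₁ (ringExpChar k)]
  intro x hx
  obtain ⟨n, y, hy⟩ := IsPurelyInseparable.pow_mem k (ringExpChar k) (⟨x, hx⟩ : l)
  refine ⟨n, algebraMap k K y, ?_⟩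
  have h1 : algebraMap K L₁ (algebraMap k K y) = algebraMap k L₁ y :=
    (IsScalarTower.algebraMap_apply k K L₁ y).symm
  have h2 : algebraMap k L₁ y = ((algebraMap k l y : l) : L₁) :=
    IsScalarTower.algebraMap_apply k l L₁ y
  rw [h1, h2, hy]
  rfl

end base

/-- **The induction base of Thm. 4.1.1 from Thm. 5.5.2** (Temkin 2013, proof of Thm. 4.1.1,
Step 0, p. 47: "The induction base `D_{K/k} = 0` corresponds to the case of Abhyankar valuations,
which will be established in §5: it is a particular case of Theorem 5.5.2"): with `L := K(l)`,
which contains `l`, is purely inseparable over `K` and generates `L₁ = lK₁` over `K₁`, the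
conclusion of Thm. 5.5.2 (i) (`n = 1`) is that of Thm. 4.1.1 (`n = 1`), i.e.
`Temkin2013DescentFor k K O`; the extra hypotheses of `Temkin2013DescentAbhyankar` (height
`≤ 1`, `X` normal) are not used. PROVED. [cite: Temkin2013, proof of Thm. 4.1.1, Step 0 (p. 47)] -/
theorem Temkin2013Abhyankar.descentAbhyankar (h : Temkin2013Abhyankar.{u}) :
    Temkin2013DescentAbhyankar.{u} := by
  intro k K _ _ _ hfg O hk _ hD A hAO hAfg hAfr _ K₁ _ _ hK₁ O₁ hO₁
  obtain ⟨L₁, iF, iAK₁, iAK, iAk, iT₁, iT₂, hfin, hpi, l, hlfin, hlpi, hlK₁, A', hAA', hA'O,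
    hA'fg, hA'fr, O₁', hO₁', N, hN, hNint, hNfg, hNfr, hsm, hsep, hreg⟩ :=
    h k K hfg O hk hD A hAO hAfg hAfr K₁ hK₁ O₁ hO₁
  haveI := hlpi
  refine ⟨L₁, iF, iAK₁, iAK, iAk, iT₁, iT₂, hfin, hpi, l, hlfin, hlpi,
    IntermediateField.adjoin K (l : Set L₁), IntermediateField.subset_adjoin K _,
    isPurelyInseparable_adjoin_of_isPurelyInseparable l, ?_, A', hAA', hA'O, hA'fg, hA'fr,
    O₁', hO₁', N, hN, hNint, hNfg, hNfr, hsm, hsep, hreg⟩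
  -- `K₁[K(l)] ⊇ K₁[l] = L₁`
  refine top_le_iff.mp (hlK₁ ▸ Algebra.adjoin_mono ?_)
  exact IntermediateField.subset_adjoin K _

/-- In the shape of the filtration: `Temkin2013Abhyankar → Temkin2013DescentDefectLE 0`.
[folklore] -/
theorem Temkin2013Abhyankar.defectLE_zero (h : Temkin2013Abhyankar.{u}) :
    Temkin2013DescentDefectLE.{u} 0 :=
  temkin2013DescentAbhyankar_iff.mp h.descentAbhyankar

/-! ### The frontier with Thm. 5.5.2 (i) as the base -/

/-- Thm. 4.1.1 (`n = 1`) from Thm. 5.5.2 (i) and the induction step on the transcendence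
defect. [cite: Temkin2013, proof of Thm. 4.1.1 (pp. 47–50)] -/
theorem Temkin2013Descent.of_abhyankar (hA : Temkin2013Abhyankar.{u})
    (hs : Temkin2013DescentDefectStep.{u}) : Temkin2013Descent.{u} :=
  Temkin2013Descent.of_defect hA.descentAbhyankar hs

/-- **The corrected relative Thm. 1.3.2 from three results of the paper by their own numbers**:
Thm. 5.5.2 (i) (Abhyankar valuations, toric/logarithmic §5), the induction step on the
transcendence defect (§4.1, Steps 1–4) and the induction step on the height (§4.2).
[cite: Temkin2013, Sections 4–5] -/
theorem Temkin2013Relative.of_abhyankar_frontier (hA : Temkin2013Abhyankar.{u})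
    (hs : Temkin2013DescentDefectStep.{u}) (hh : Temkin2013HeightStepOfDescent.{u}) :
    Temkin2013Relative.{u} :=
  Temkin2013Relative.of_defect_frontier hA.descentAbhyankar hs hh

/-- … hence the weak absolute form `Temkin2013` used by the routes. [cite: Temkin2013, Thm. 1.3.2] -/
theorem Temkin2013.of_abhyankar_frontier (hA : Temkin2013Abhyankar.{u})
    (hs : Temkin2013DescentDefectStep.{u}) (hh : Temkin2013HeightStepOfDescent.{u}) :
    Temkin2013.{u} :=
  Temkin2013.of_defect_frontier hA.descentAbhyankar hs hh

/-- The height-`≤ 1` case (Thm. 1.3.2 in height `≤ 1`) from Thm. 5.5.2 (i) and the defect step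
alone. [cite: Temkin2013, Section 4.1] -/
theorem Temkin2013HeightLeOne.of_abhyankar_frontier (hA : Temkin2013Abhyankar.{u})
    (hs : Temkin2013DescentDefectStep.{u}) : Temkin2013HeightLeOne.{u} :=
  Temkin2013HeightLeOne.of_defect_frontier hA.descentAbhyankar hs

end Literature.AlgebraicGeometry.Resolution

end
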